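import Summits.CriticalPhenomena.PercolationContinuityZ3.Theorems.PercNearOneGluingNoHeavyLowerTailSahiCombReadOnce
import Summits.CriticalPhenomena.PercolationContinuityZ3.Theorems.PercNearOneGluingNoHeavyLowerTailSahiCombMinDegreeTwoFree

/-!
# The comb hierarchy for Sahi's `E_k`: (M⁺⁺) — minimal-multidegree comb positivity — transfers along READ-ONCE substitution

Support file of the one-cut programme (crux `NoHeavyLowerTail`, stmt-CriticalPhenomena-4575; cell `prim-masterthm`, seat P5 gen 4; report
`P5-LORENTZIAN-TEST.md` §9).  `…SahiCombReadOnce` (seat P3) proved that comb positivity at the UNIFORM multidegree `k` is preserved when independent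
gadgets `G e` (determined by the disjoint fibres of `π : ι → κ`) are substituted for the coordinates.  The same substitution respects ANY multidegree:
a certificate of multidegree `c` on `κ` becomes one of multidegree `c ∘ π` on `ι` (the Bernstein monomial `∏_e p_e^{j_e}(1−p_e)^{c_e−j_e}` becomes
`∏_e μ_q(G e)^{j_e}(1−μ_q(G e))^{c_e−j_e}`, comb-positive at `Σ_e c_e·1_{fibre e} = c ∘ π`).  Hence the minimal-degree row (M⁺⁺) of
`…SahiCombMinDegree` transfers:
* `combPos_bern_gadget_deg`, **`CombPos.readOnce_deg`** — degree-`c` read-once transfer;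
* **`combPos_sahiE_ind_monomials_minDeg`** — UNCONDITIONAL, every `n`: for monomials `⋂_{e ∈ S_j} G e` in independent gadgets, `E_n` is comb-positive at
  multidegree `i ↦ #{j : π i ∈ S_j}` (the cylinder theorem `…CylinderMinDegree` pushed through the gadgets);
* **`combPos_sahiE_ind_readOnce_twoFree_minDeg`** — UNCONDITIONAL, every `n`: read-once images of families with at most two non-cylinder members are
  comb-positive at `(Σ_j 1_{esupp U_j}) ∘ π`;
* `minDegPos_readOnce` — GIVEN (M⁺⁺-k) on `κ`, the read-once images on `ι` are comb-positive at `r ∘ π`.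
HONEST LABEL: (M⁺⁺-k)/(M⁺-k) for general increasing events remain OPEN (k ≥ 3). [this work]
-/

noncomputable section

open scoped Classical

namespace Summit.CriticalPhenomena.PercolationContinuityZ3.Theorems

open Finset Function MeasureTheory
open Literature.Combinatorics.Sahi2008
open Literature.Probability.LatticeModels (prodBernoulli)
open Literature.Probability.Percolation (DeterminedBy determinedBy_iff determinedBy_univ)
open Literature.Probability.Percolation.DecisionTree (ind ind_of_mem ind_of_not_mem ind_nonneg)
open Literature.Probability.Percolation.BHK2006 (weight)
open SahiComb SahiCombTensor SahiCombReadOnce SahiCylMinDeg SahiMinDeg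

namespace SahiMinDegReadOnce

variable {ι κ : Type} [Fintype ι] [Fintype κ]

/-- The substituted Bernstein basis function of multidegree `c` is comb-positive at multidegree `c ∘ π`. [this work] -/
theorem combPos_bern_gadget_deg (π : ι → κ) {G : κ → Set (Set ι)} (hG : ∀ e, DeterminedBy (G e) {i | π i = e}) (c : κ → ℕ) {j : κ → ℕ}
    (hj : j ∈ box c) :
    CombPos (fun i => c (π i)) (fun q => ∏ e, ((prodBernoulli q).real (G e)) ^ (j e) * (1 - (prodBernoulli q).real (G e)) ^ (c e - j e)) := by
  set δ : κ → ι → ℕ := fun e i => if i ∈ univ.filter (fun i => π i ≠ e) then 0 else 1 with hδ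
  have hterm : ∀ e, CombPos (j e • δ e + (c e - j e) • δ e)
      (fun q => ((prodBernoulli q).real (G e)) ^ (j e) * (1 - (prodBernoulli q).real (G e)) ^ (c e - j e)) := fun e =>
    ((combPos_real_gadget π hG e).pow (j e)).mul ((combPos_one_sub_real_gadget π hG e).pow (c e - j e))
  refine (SahiComb.CombPos.prod univ fun e _ => hterm e).mono fun i => ?_
  have hji : j (π i) ≤ c (π i) := mem_box.1 hj (π i)
  simp only [Finset.sum_apply, Pi.add_apply, Pi.smul_apply, smul_eq_mul, hδ, Finset.mem_filter, Finset.mem_univ, true_and]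
  rw [Finset.sum_eq_single (π i)]
  · simp only [ne_eq, not_true_eq_false, if_false, mul_one]; omega
  · intro e _ he; simp [Ne.symm he]
  · intro h; exact absurd (mem_univ _) h

/-- **Comb positivity at ANY multidegree is closed under read-once substitution**: a certificate of multidegree `c` for `E_k(μ_p; 1_U)` on `[0,1]^κ` gives one
of multidegree `c ∘ π` for `E_k(μ_q; 1_{U∘G})` on `[0,1]^ι`. [this work] -/
theorem CombPos.readOnce_deg (π : ι → κ) (G : κ → Set (Set ι)) (hG : ∀ e, DeterminedBy (G e) {i | π i = e}) {k : ℕ} {c : κ → ℕ}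
    {U : Fin k → Set (Set κ)} (hU : CombPos c (fun p => sahiE (bernoulliWeight p) k (fun j => ind (U j)))) :
    CombPos (fun i => c (π i)) (fun q => sahiE (bernoulliWeight q) k (fun j => ind {ω : Set ι | {e | ω ∈ G e} ∈ U j})) := by
  obtain ⟨N, hN, hrep⟩ := hU
  have key : ∀ q : ι → unitInterval, sahiE (bernoulliWeight q) k (fun j => ind {ω : Set ι | {e | ω ∈ G e} ∈ U j}) =
      ∑ j ∈ box c, N j * ∏ e, ((prodBernoulli q).real (G e)) ^ (j e) * (1 - (prodBernoulli q).real (G e)) ^ (c e - j e) := by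
    intro q
    let c' : κ → unitInterval := fun e => ⟨(prodBernoulli q).real (G e), measureReal_nonneg, measureReal_le_one⟩
    have hw : (weight fun e => (prodBernoulli q).real (G e)) = bernoulliWeight c' := rfl
    have hc := hrep c'
    dsimp only at hc
    rw [sahiE_readOnce_eq π G hG q U, hw, hc]
    rfl
  refine (CombPos.sum (box c) fun j hj => ((combPos_bern_gadget_deg π hG c hj).smul (hN j))).congr key

/-- **GIVEN (M⁺⁺-k)**, read-once images are comb-positive at the pulled-back minimal multidegree `r ∘ π`. [this work] -/
theorem minDegPos_readOnce {k : ℕ} (hN : MasterFamilyCombMinDegPos k) (π : ι → κ) (G : κ → Set (Set ι))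
    (hG : ∀ e, DeterminedBy (G e) {i | π i = e}) (U : Fin k → Set (Set κ)) (hU : ∀ j, IsUpperSet (U j)) :
    CombPos (fun i => ∑ j, if π i ∈ esupp (U j) then 1 else 0)
      (fun q => sahiE (bernoulliWeight q) k (fun j => ind {ω : Set ι | {e | ω ∈ G e} ∈ U j})) := by
  have h := CombPos.readOnce_deg (c := fun e => ∑ j, if e ∈ esupp (U j) then 1 else (0 : ℕ)) π G hG (hN κ U hU)
  exact h

/-- **Monomials in independent events, minimal degree** (unconditional, every `n`): for gadgets `G e` determined by the disjoint fibres of `π` and index sets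
`S_j ⊆ κ`, `q ↦ E_n(μ_q; 1_{⋂_{e∈S_0} G e},…)` is comb-positive at multidegree `i ↦ #{j : π i ∈ S_j}`. [this work] -/
theorem combPos_sahiE_ind_monomials_minDeg (π : ι → κ) (G : κ → Set (Set ι)) (hG : ∀ e, DeterminedBy (G e) {i | π i = e}) {n : ℕ}
    (S : Fin n → Set κ) :
    CombPos (fun i => ∑ j, if π i ∈ S j then 1 else 0) (fun q => sahiE (bernoulliWeight q) n (fun j => ind (⋂ e ∈ S j, G e))) := by
  have h := CombPos.readOnce_deg (c := fun e => ∑ j, if e ∈ S j then 1 else (0 : ℕ)) π G hG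
    (combPos_sahiE_ind_cylinders_minDegree (ι := κ) n S)
  refine h.congr fun q => ?_
  congr 1; funext j; rw [← readOnce_cylinder G (S j)]

/-- **Read-once images of families with at most two non-cylinder members, minimal degree** (unconditional, every `n`). [this work] -/
theorem combPos_sahiE_ind_readOnce_twoFree_minDeg (π : ι → κ) (G : κ → Set (Set ι)) (hG : ∀ e, DeterminedBy (G e) {i | π i = e}) {n : ℕ}
    (U : Fin n → Set (Set κ)) (hU : ∀ j, IsUpperSet (U j))
    (hE : ∃ E : Finset (Fin n), E.card ≤ 2 ∧ ∀ j, j ∉ E → ∃ S : Set κ, U j = {ω : Set κ | S ⊆ ω}) :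
    CombPos (fun i => ∑ j, if π i ∈ esupp (U j) then 1 else 0)
      (fun q => sahiE (bernoulliWeight q) n (fun j => ind {ω : Set ι | {e | ω ∈ G e} ∈ U j})) := by
  have h := CombPos.readOnce_deg (c := fun e => ∑ j, if e ∈ esupp (U j) then 1 else (0 : ℕ)) π G hG
    (combPos_sahiE_ind_allButTwoCylinders_minDeg n U hU hE)
  exact h

end SahiMinDegReadOnce

end Summit.CriticalPhenomena.PercolationContinuityZ3.Theorems
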